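import Summits.AtomisticToContinuum.FouriersLaw.Theorems.BondHeatUncertaintySubdiffusiveBondHeatOfDeficitCesaroEW
import Summits.AtomisticToContinuum.FouriersLaw.Theorems.BondHeatUncertaintySubdiffusiveBondHeatOhmicFloor

/-!
# `SubdiffusiveBondHeat` from the two `N`-uniform pieces at the bath bond: Ohmic floor ⊕ Edwards–Wilkinson transient

Crux `stmt-AtomisticToContinuum-9120` (`BondHeatUncertainty.SubdiffusiveBondHeat`, (S)), line `bath-bond-deficit-integral`.
The line's single open stub `stub_deficitCesaroEW` (`∫₀ᵗ (1 − θ_N) ≤ C√t` on `[1, cN²]`, `N ≥ N₀`; the EW ¼-law of the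
heat exchanged with one reservoir) splits, by the bookkeeping `1 − θ_N(s) = (1 − θ_N(s) − E_N) + E_N`, into

* the OHMIC FLOOR `E_N = 1 − (γ/T²)∫_{(0,∞)} K_N ≤ C₁/N` for `N ≥ N₀` (bounded response seen from the contact:
  `D_N = (N−1)γE_N` by `BoundaryEscapeDeficit.ResponseIdentity`; barrier `HasBoundedResponse` met head-on; supplied
  CONDITIONALLY by the landed bridges `stub_ohmicFloor_of_escapeLaw` (from `EscapeLaw`, stmt-12234) and
  `stub_ohmicFloor_of_tail_crossover` (from stmt-12235/12236)), and
* the EDWARDS–WILKINSON TRANSIENT `∫₀ᵗ (1 − θ_N(s) − E_N) ds ≤ C₂√t` for `1 ≤ t ≤ cN²`, `N ≥ N₀` (the `u^{-3/2}`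
  first-return law of the boundary kinetic-temperature autocorrelation, integrated twice; no supplier in tree or print),

with `θ_N(s) = (γ/T²)∫₀ˢ K_N`, `K_N(u) = ∫ (p₀² − T)·P_u(p₀² − T) dμ_T^N` VERBATIM the `let θ / K / E` of route
`BoundaryEscapeDeficit`.  This file lands the glue, both pieces taken as explicit HYPOTHESES (no definition, no `sorry`):

* `cesaro_le_of_floor_transient` — abstract Cesàro bookkeeping: `∫₀ᵗ(f − E) ≤ C₂√t`, `E ≤ C₁/N`, `1 ≤ t ≤ cN²` give
  `∫₀ᵗ f ≤ (max C₂ 0 + max C₁ 0 · √c)√t` (junk-safe: a non-integrable `f` makes the left side `0`);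
* `subdiffusiveBondHeat_of_ohmicFloor_transientEW` — Ohmic floor → EW transient → (S), through the landed transfer
  `subdiffusiveBondHeat_of_deficitCesaroEW` (p96625);
* `subdiffusiveBondHeat_of_escapeLaw_transientEW` — the same with the floor discharged from the sibling route's target
  `BoundaryEscapeDeficit.EscapeLaw` (stmt-AtomisticToContinuum-12234) by the landed `stub_ohmicFloor_of_escapeLaw`:
  `EscapeLaw → EW transient → (S)`.

The decomposition and the bookkeeping lemma are the crux-strategist's (D1) (`Cruxes/SubdiffusiveBondHeat/STRATEGY-CENSUS.md`
§Decomposition, artifact `StrategistSplitGlue.lean`, planner-cstrat-stmt-AtomisticToContinuum-9120-s1-0), made importable here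
so that a conditional-bridge version of the route can cite it.  Nothing here closes the item: both hypotheses are open-problem
calibre (the first IS bounded response at the contact; the second is an `N`-uniform mixing law for the deterministic
anharmonic bulk), see the census.  At the harmonic member `lam = β = 0` the floor fails (`E_N = 1/8`, `D_N = (N−1)/8`) and so
does the transient bound (deficit plateau `0.148 > 1/8` before the first echo), `Cruxes/SubdiffusiveBondHeat/Disproof.lean` §4–§6.
-/

noncomputable section

open MeasureTheory Set Filter Topology

namespace Summit.AtomisticToContinuum.FouriersLaw.Theorems.SubdiffusiveBondHeat

open Literature.MathematicalPhysics.KineticTheory.HeatConduction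
open Summit.AtomisticToContinuum.FouriersLaw.Theses.BondHeatUncertainty (SubdiffusiveBondHeat)
open Summit.AtomisticToContinuum.FouriersLaw.Theses.BoundaryEscapeDeficit (EscapeLaw)

/-- **Cesàro bookkeeping** (abstract): if `∫₀ᵗ (f − E) ≤ C₂ √t`, `E ≤ C₁ / N`, `1 ≤ t ≤ c N²` (`c > 0`, `N ≥ 1`), then
`∫₀ᵗ f ≤ (max C₂ 0 + max C₁ 0 · √c) √t`, using `t·E ≤ max C₁ 0 · t/N ≤ max C₁ 0 · √c √t` on the window.  Junk-safe: if
`f` is not interval-integrable the left side is `0 ≤` the right side.  (Crux-strategist s1's `cesaro_of_floor_transient`.)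
[folklore] -/
theorem cesaro_le_of_floor_transient {f : ℝ → ℝ} {E C₁ C₂ c t : ℝ} {N : ℕ} (hN : 0 < N) (hc : 0 < c)
    (ht : 1 ≤ t) (htc : t ≤ c * (N : ℝ) ^ 2) (hfloor : E ≤ C₁ / (N : ℝ))
    (htrans : (∫ s in (0 : ℝ)..t, (f s - E)) ≤ C₂ * Real.sqrt t) :
    (∫ s in (0 : ℝ)..t, f s) ≤ (max C₂ 0 + max C₁ 0 * Real.sqrt c) * Real.sqrt t := by
  have ht0 : 0 ≤ t := le_trans zero_le_one ht
  have hNr : (0 : ℝ) < N := by exact_mod_cast hN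
  have hsqrt0 : 0 ≤ Real.sqrt t := Real.sqrt_nonneg _
  have hsqc0 : 0 ≤ Real.sqrt c := Real.sqrt_nonneg _
  have hwin : t / (N : ℝ) ≤ Real.sqrt c * Real.sqrt t := by
    have h1 : Real.sqrt t ≤ Real.sqrt c * (N : ℝ) := by
      calc Real.sqrt t ≤ Real.sqrt (c * (N : ℝ) ^ 2) := Real.sqrt_le_sqrt htc
        _ = Real.sqrt c * (N : ℝ) := by rw [Real.sqrt_mul hc.le, Real.sqrt_sq hNr.le]
    rw [div_le_iff₀ hNr]
    calc t = Real.sqrt t * Real.sqrt t := (Real.mul_self_sqrt ht0).symm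
      _ ≤ Real.sqrt t * (Real.sqrt c * (N : ℝ)) := mul_le_mul_of_nonneg_left h1 hsqrt0
      _ = Real.sqrt c * Real.sqrt t * (N : ℝ) := by ring
  have htarget0 : 0 ≤ (max C₂ 0 + max C₁ 0 * Real.sqrt c) * Real.sqrt t := by positivity
  by_cases hf : IntervalIntegrable f volume 0 t
  · have hsplit : (∫ s in (0 : ℝ)..t, f s) = (∫ s in (0 : ℝ)..t, (f s - E)) + t * E := by
      rw [intervalIntegral.integral_sub hf intervalIntegrable_const, intervalIntegral.integral_const,
        sub_zero, smul_eq_mul]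
      ring
    have hfl : t * E ≤ t * (C₁ / (N : ℝ)) := mul_le_mul_of_nonneg_left hfloor ht0
    have hfl' : t * (C₁ / (N : ℝ)) ≤ max C₁ 0 * (Real.sqrt c * Real.sqrt t) := by
      calc t * (C₁ / (N : ℝ)) = C₁ * (t / (N : ℝ)) := by ring
        _ ≤ max C₁ 0 * (t / (N : ℝ)) :=
            mul_le_mul_of_nonneg_right (le_max_left _ _) (div_nonneg ht0 hNr.le)
        _ ≤ max C₁ 0 * (Real.sqrt c * Real.sqrt t) := mul_le_mul_of_nonneg_left hwin (le_max_right _ _)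
    have htr : (∫ s in (0 : ℝ)..t, (f s - E)) ≤ max C₂ 0 * Real.sqrt t :=
      htrans.trans (mul_le_mul_of_nonneg_right (le_max_left _ _) hsqrt0)
    rw [hsplit]
    calc (∫ s in (0 : ℝ)..t, (f s - E)) + t * E
        ≤ max C₂ 0 * Real.sqrt t + max C₁ 0 * (Real.sqrt c * Real.sqrt t) := by linarith
      _ = (max C₂ 0 + max C₁ 0 * Real.sqrt c) * Real.sqrt t := by ring
  · rw [intervalIntegral.integral_undef hf]
    exact htarget0

/-- **(S) from Ohmic floor ⊕ Edwards–Wilkinson transient at the bath bond.**  Hypotheses (both `N`-uniform, both open):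
(floor) `E_N = 1 − (γ/T²)∫_{(0,∞)}K_N ≤ C₁/N` for `N ≥ N₀`; (transient) `∫₀ᵗ (1 − θ_N(s) − E_N) ds ≤ C₂√t` for
`1 ≤ t ≤ cN²`, `N ≥ N₀` — `θ_N`, `K_N`, `E_N` VERBATIM the `let`s of route `BoundaryEscapeDeficit`.  Proof: Cesàro bookkeeping
`∫₀ᵗ(1 − θ_N) ≤ (max C₂ 0 + max C₁ 0 √c)√t` (`cesaro_le_of_floor_transient`) and the landed transfer
`subdiffusiveBondHeat_of_deficitCesaroEW` (p96625).  (Crux-strategist s1's decomposition (D1), made importable.) [folklore] -/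
theorem subdiffusiveBondHeat_of_ohmicFloor_transientEW :
    (∀ ω₂ lam β γ : ℝ, 0 < ω₂ → 0 < lam → 0 < β → 0 < γ → ∀ T : ℝ, 0 < T →
      ∃ C₁ : ℝ, ∃ N₀ : ℕ, ∀ N : ℕ, N₀ ≤ N →
        1 - γ / T ^ 2 * (∫ u in Set.Ioi (0 : ℝ),
          if h : 0 < N then
            ∫ z, ((z.2 ⟨0, h⟩) ^ 2 - T) *
                (∫ y, ((y.2 ⟨0, h⟩) ^ 2 - T) ∂((pinnedChain ω₂ lam β γ).transitionKernel N T T u.toNNReal z))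
              ∂((pinnedChain ω₂ lam β γ).gibbsMeasure N T)
          else 0) ≤ C₁ / (N : ℝ)) →
    (∀ ω₂ lam β γ : ℝ, 0 < ω₂ → 0 < lam → 0 < β → 0 < γ → ∀ T : ℝ, 0 < T →
      ∃ C₂ c : ℝ, 0 < c ∧ ∃ N₀ : ℕ, ∀ N : ℕ, N₀ ≤ N → ∀ t : ℝ, 1 ≤ t → t ≤ c * (N : ℝ) ^ 2 →
        (∫ s in (0 : ℝ)..t,
          (1 - γ / T ^ 2 * (∫ u in (0 : ℝ)..s,
              if h : 0 < N then
                ∫ z, ((z.2 ⟨0, h⟩) ^ 2 - T) *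
                    (∫ y, ((y.2 ⟨0, h⟩) ^ 2 - T)
                      ∂((pinnedChain ω₂ lam β γ).transitionKernel N T T u.toNNReal z))
                  ∂((pinnedChain ω₂ lam β γ).gibbsMeasure N T)
              else 0) -
            (1 - γ / T ^ 2 * (∫ u in Set.Ioi (0 : ℝ),
              if h : 0 < N then
                ∫ z, ((z.2 ⟨0, h⟩) ^ 2 - T) *
                    (∫ y, ((y.2 ⟨0, h⟩) ^ 2 - T)
                      ∂((pinnedChain ω₂ lam β γ).transitionKernel N T T u.toNNReal z))
                  ∂((pinnedChain ω₂ lam β γ).gibbsMeasure N T)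
              else 0)))) ≤ C₂ * Real.sqrt t) →
    Summit.AtomisticToContinuum.FouriersLaw.Theses.BondHeatUncertainty.SubdiffusiveBondHeat := by
  intro hO hT
  refine subdiffusiveBondHeat_of_deficitCesaroEW fun ω₂ lam β γ hω hl hβ hγ T hT' => ?_
  obtain ⟨C₁, N₁, hC₁⟩ := hO ω₂ lam β γ hω hl hβ hγ T hT'
  obtain ⟨C₂, c, hc, N₂, hC₂⟩ := hT ω₂ lam β γ hω hl hβ hγ T hT'
  refine ⟨max C₂ 0 + max C₁ 0 * Real.sqrt c, c, hc, max (max N₁ N₂) 1, fun N hN t ht htc => ?_⟩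
  have hN₁ : N₁ ≤ N := le_trans ((le_max_left _ _).trans (le_max_left _ _)) hN
  have hN₂ : N₂ ≤ N := le_trans ((le_max_right _ _).trans (le_max_left _ _)) hN
  have hN0 : 0 < N := lt_of_lt_of_le Nat.one_pos (le_trans (le_max_right _ _) hN)
  exact cesaro_le_of_floor_transient hN0 hc ht htc (hC₁ N hN₁) (hC₂ N hN₂ t ht htc)

/-- **(S) from `EscapeLaw` ⊕ the Edwards–Wilkinson transient.**  The Ohmic floor is discharged CONDITIONALLY from the
sibling route's target `BoundaryEscapeDeficit.EscapeLaw` (stmt-AtomisticToContinuum-12234, UNPROVED — taken as a hypothesis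
by name) through the landed bridge `stub_ohmicFloor_of_escapeLaw`; the transient hypothesis is as in
`subdiffusiveBondHeat_of_ohmicFloor_transientEW`.  So `EscapeLaw ∧ (EW transient) ⟹ SubdiffusiveBondHeat`. [folklore] -/
theorem subdiffusiveBondHeat_of_escapeLaw_transientEW :
    Summit.AtomisticToContinuum.FouriersLaw.Theses.BoundaryEscapeDeficit.EscapeLaw →
    (∀ ω₂ lam β γ : ℝ, 0 < ω₂ → 0 < lam → 0 < β → 0 < γ → ∀ T : ℝ, 0 < T →
      ∃ C₂ c : ℝ, 0 < c ∧ ∃ N₀ : ℕ, ∀ N : ℕ, N₀ ≤ N → ∀ t : ℝ, 1 ≤ t → t ≤ c * (N : ℝ) ^ 2 →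
        (∫ s in (0 : ℝ)..t,
          (1 - γ / T ^ 2 * (∫ u in (0 : ℝ)..s,
              if h : 0 < N then
                ∫ z, ((z.2 ⟨0, h⟩) ^ 2 - T) *
                    (∫ y, ((y.2 ⟨0, h⟩) ^ 2 - T)
                      ∂((pinnedChain ω₂ lam β γ).transitionKernel N T T u.toNNReal z))
                  ∂((pinnedChain ω₂ lam β γ).gibbsMeasure N T)
              else 0) -
            (1 - γ / T ^ 2 * (∫ u in Set.Ioi (0 : ℝ),
              if h : 0 < N then
                ∫ z, ((z.2 ⟨0, h⟩) ^ 2 - T) *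
                    (∫ y, ((y.2 ⟨0, h⟩) ^ 2 - T)
                      ∂((pinnedChain ω₂ lam β γ).transitionKernel N T T u.toNNReal z))
                  ∂((pinnedChain ω₂ lam β γ).gibbsMeasure N T)
              else 0)))) ≤ C₂ * Real.sqrt t) →
    Summit.AtomisticToContinuum.FouriersLaw.Theses.BondHeatUncertainty.SubdiffusiveBondHeat := fun hE hT =>
  subdiffusiveBondHeat_of_ohmicFloor_transientEW (stub_ohmicFloor_of_escapeLaw hE) hT

end Summit.AtomisticToContinuum.FouriersLaw.Theorems.SubdiffusiveBondHeat

end
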